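import Literature.Geometry.Lorentzian.KerrSchildMultiplierCurrent
import Literature.Geometry.Lorentzian.MinkowskiRadialMultiplier
import Literature.Geometry.Lorentzian.KerrConvergence
import Summits.FinalStateConjecture.FinalStateConjecture.Theorems.ClusterCompletenessAdiabaticMultiKerrILEDZonePumping
import Summits.FinalStateConjecture.FinalStateConjecture.Theorems.ClusterCompletenessAdiabaticMultiKerrILEDZoneDivergence

/-! # Route ClusterCompleteness — crux `AdiabaticMultiKerrILED`: the boosted zone term
# (Euler identity about the centre and boost-stationarity)

Helper file for the crux `stmt-FinalStateConjecture-14310` (line `Sketch`, lead c6 wave 3, card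
milne-hubble-current): the coefficient field of the crux is `G = η − Σᵢ Tᵢ` with the BOOSTED zone
terms `Tᵢ(y)^{μν} = χ(r) · 2H · (Λℓ♯)^μ (Λℓ♯)^ν` evaluated at the rest-frame point
`q y = poincareInv Λ c y = Λ⁻¹(y − c)` of hole `i` (`c = (0, p)`, `r = Kerr.radius a (q y)`,
`H = Kerr.scalarH M a (q y)`, `ℓ♯ = Kerr.nullVector a (q y)`,
`χ(r) = Real.smoothTransition (2 − r/(8M))`). Two facts:
* (`a = 0`) Euler's identity for the homothety about the event `c`: `q` is affine with
  `q(c + t(x − c)) = t · q x`, and `r`, `H`, `ℓ♯` are homogeneous of degrees `1`, `−1`, `0`, so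
  `dTᵢ(x)[x − c] = (r χ'(r) − χ(r)) · 2H · (Λℓ♯)^μ (Λℓ♯)^ν` (`fderiv_cruxTerm_self_schwarzschild`);
* (all `M, a`) stationarity along the boost direction `u = Λ ∂_{t*}`: `q(x + s u) = q x + s ∂_{t*}`
  and `r`, `H`, `ℓ♯` do not depend on `t*`, so `dTᵢ(x)[Λ ∂_{t*}] = 0`
  (`fderiv_cruxTerm_boostDirection_zero`).
[folklore] -/

noncomputable section

-- the doubled `FinalStateConjecture.FinalStateConjecture` path component trips dupNamespace
set_option linter.dupNamespace false

open scoped BigOperators Topology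
open Filter Literature.Geometry.Lorentzian

namespace Summit.FinalStateConjecture.FinalStateConjecture.Theorems

/-! ### The rest-frame map `q = poincareInv Λ c` along lines -/

/-- The rest-frame map `q y = Λ⁻¹(y − c)` along the lab line `s ↦ x + s Λv`:
`q(x + s Λv) = q x + s v` (linearity of `Λ⁻¹` and `Λ⁻¹ Λ = id`). [folklore] -/
theorem boostedZone_poincareInv_add_smul_map (Λ : lorentzGroup) (c x v : E4) (s : ℝ) :
    poincareInv Λ c (x + s • (Λ : E4 ≃L[ℝ] E4) v) = poincareInv Λ c x + s • v := by
  unfold poincareInv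
  rw [add_sub_right_comm, map_add, map_smul, ContinuousLinearEquiv.symm_apply_apply]

/-- The rest-frame map `q y = Λ⁻¹(y − c)` along the ray from the event `c` through `x`:
`q(c + t(x − c)) = t · q x` (linearity of `Λ⁻¹`). [folklore] -/
theorem boostedZone_poincareInv_center_add_smul (Λ : lorentzGroup) (c x : E4) (t : ℝ) :
    poincareInv Λ c (c + t • (x - c)) = t • poincareInv Λ c x := by
  unfold poincareInv
  rw [add_sub_cancel_left, map_smul]

/-- The rest-frame map `q y = Λ⁻¹(y − c)` is differentiable (it is affine). [folklore] -/
theorem boostedZone_differentiableAt_poincareInv (Λ : lorentzGroup) (c x : E4) :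
    DifferentiableAt ℝ (poincareInv Λ c) x := by
  unfold poincareInv
  exact (Λ : E4 ≃L[ℝ] E4).symm.differentiableAt.comp x (differentiableAt_id.sub_const c)

/-! ### Euler's identity about a centre -/

/-- **Euler's identity along a ray from a centre, abstract form.** If `F : ℝ⁴ → ℝ` is
differentiable at `x` and its restriction to the open ray `t ↦ c + t (x − c)` (`t > 0`) agrees with
a one-variable function `φ` having derivative `d` at `t = 1`, then `dF(x)[x − c] = d` (chain rule
along the ray and uniqueness of the derivative). [folklore] -/
theorem boostedZone_fderiv_apply_sub_eq_of_hasDerivAt {F : E4 → ℝ} {x c : E4} {φ : ℝ → ℝ}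
    {d : ℝ} (hF : DifferentiableAt ℝ F x) (hφ : HasDerivAt φ d 1)
    (h : ∀ t : ℝ, 0 < t → F (c + t • (x - c)) = φ t) : fderiv ℝ F x (x - c) = d := by
  have hline : HasDerivAt (fun t : ℝ ↦ c + t • (x - c)) (x - c) 1 :=
    (((hasDerivAt_id' (x := (1 : ℝ))).smul_const (x - c)).const_add c).congr_deriv
      (one_smul ℝ (x - c))
  have hx1 : x = c + (1 : ℝ) • (x - c) := by rw [one_smul, add_sub_cancel]
  have h1 : HasDerivAt (fun t : ℝ ↦ F (c + t • (x - c))) (fderiv ℝ F x (x - c)) 1 :=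
    hF.hasFDerivAt.comp_hasDerivAt_of_eq 1 hline hx1
  have h2 : HasDerivAt (fun t : ℝ ↦ F (c + t • (x - c))) d 1 := by
    refine hφ.congr_of_eventuallyEq ?_
    filter_upwards [lt_mem_nhds one_pos] with t ht
    exact h t ht
  exact h1.unique h2

/-! ### The boosted zone term along rays from the centre (`a = 0`) -/

/-- **Scaling of the boosted zone term along a rest-frame ray** (`a = 0`): for `t > 0` and any
linear `L`,
`χ(r(tz)) · 2H(tz) · (Lℓ♯(tz))^μ (Lℓ♯(tz))^ν = χ(t r) · t⁻¹ · (2H(z) (Lℓ♯(z))^μ (Lℓ♯(z))^ν)`,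
`r = Kerr.radius 0 z`, by the degree-`1`, `−1`, `0` homogeneity of `r`, `H`, `ℓ♯`
(`Kerr.radius_smul`, `Kerr.scalarH_smul`, `Kerr.nullVector_dilate`; Kerr–Schild 1965, §2).
[folklore] -/
theorem boostedZone_cruxTerm_smul (M : ℝ) (L : E4 ≃L[ℝ] E4) (z : E4) (μ ν : Fin 4) {t : ℝ}
    (ht : 0 < t) :
    Real.smoothTransition (2 - Kerr.radius 0 (t • z) / (8 * M)) *
        (2 * Kerr.scalarH M 0 (t • z)) * (L (Kerr.nullVector 0 (t • z))) μ *
          (L (Kerr.nullVector 0 (t • z))) ν =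
      Real.smoothTransition (2 - t * Kerr.radius 0 z / (8 * M)) * t⁻¹ *
        (2 * Kerr.scalarH M 0 z * (L (Kerr.nullVector 0 z)) μ * (L (Kerr.nullVector 0 z)) ν) := by
  have hr : Kerr.radius 0 (t • z) = t * Kerr.radius 0 z := by
    simpa using Kerr.radius_smul ht 0 z
  have hl : Kerr.nullVector 0 (t • z) = Kerr.nullVector 0 z := by
    simpa using Kerr.nullVector_dilate ht 0 z
  have hH : Kerr.scalarH M 0 (t • z) = t⁻¹ * Kerr.scalarH M 0 z := by
    have h1 := Kerr.scalarH_smul ht M 0 z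
    rw [mul_zero] at h1
    rw [Kerr.scalarH_eq_mul_scalarH_one M 0 (t • z), ← h1]
    field_simp
  rw [hr, hl, hH]
  ring

/-- **The boosted zone term is differentiable** wherever the rest-frame Kerr–Schild radius is
positive: it is a product of `χ ∘ r ∘ q`, `H ∘ q` and coordinates of the linear image `Λ (ℓ♯ ∘ q)`,
with `q` affine and `r`, `H`, `ℓ♯` smooth on `{r > 0}` (`Kerr.contDiffAt_radius`,
`Kerr.contDiffAt_scalarH`, `Kerr.contDiffAt_nullVector`). [folklore] -/
theorem boostedZone_differentiableAt_cruxTerm (M a : ℝ) (Λ : lorentzGroup) (c : E4) {x : E4}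
    (hx : 0 < Kerr.radius a (poincareInv Λ c x)) (μ ν : Fin 4) :
    DifferentiableAt ℝ (fun y ↦
      Real.smoothTransition (2 - Kerr.radius a (poincareInv Λ c y) / (8 * M)) *
        (2 * Kerr.scalarH M a (poincareInv Λ c y)) *
        ((Λ : E4 ≃L[ℝ] E4) (Kerr.nullVector a (poincareInv Λ c y))) μ *
        ((Λ : E4 ≃L[ℝ] E4) (Kerr.nullVector a (poincareInv Λ c y))) ν) x := by
  have hqd := boostedZone_differentiableAt_poincareInv Λ c x
  have hrd : DifferentiableAt ℝ (fun y ↦ Kerr.radius a (poincareInv Λ c y)) x :=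
    ((Kerr.contDiffAt_radius hx (n := 1)).differentiableAt one_ne_zero).comp x hqd
  have hHd : DifferentiableAt ℝ (fun y ↦ Kerr.scalarH M a (poincareInv Λ c y)) x :=
    ((Kerr.contDiffAt_scalarH M a hx (n := 1)).differentiableAt one_ne_zero).comp x hqd
  have hLd : DifferentiableAt ℝ
      (fun y ↦ (Λ : E4 ≃L[ℝ] E4) (Kerr.nullVector a (poincareInv Λ c y))) x :=
    (Λ : E4 ≃L[ℝ] E4).differentiableAt.comp x
      (((Kerr.contDiffAt_nullVector a hx (n := 1)).differentiableAt one_ne_zero).comp x hqd)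
  have hld : ∀ κ : Fin 4, DifferentiableAt ℝ
      (fun y ↦ ((Λ : E4 ≃L[ℝ] E4) (Kerr.nullVector a (poincareInv Λ c y))) κ) x :=
    fun κ ↦ (differentiableAt_euclidean.1 hLd) κ
  have hχd : DifferentiableAt ℝ
      (fun y ↦ Real.smoothTransition (2 - Kerr.radius a (poincareInv Λ c y) / (8 * M))) x := by
    have h :=
      (zonePumping_differentiable_cutoff M (Kerr.radius a (poincareInv Λ c x))).comp x hrd
    exact h
  exact ((hχd.mul (hHd.const_mul 2)).mul (hld μ)).mul (hld ν)

/-- **Euler's identity for the boosted zone term about its centre** (`a = 0`, any centre `c`):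
`dT(x)[x − c] = (r χ'(r) − χ(r)) · 2H · (Λℓ♯)^μ (Λℓ♯)^ν` at `q x`, `r = Kerr.radius 0 (q x) > 0`:
along the ray `t ↦ c + t(x − c)` one has `q = t · q x`, so the term equals
`χ(t r) · t⁻¹ · (2H (Λℓ♯)^μ (Λℓ♯)^ν)(q x)` (`boostedZone_cruxTerm_smul`), whose `t`-derivative at `1`
is the right-hand side (`zonePumping_hasDerivAt_profile`); conclude by
`boostedZone_fderiv_apply_sub_eq_of_hasDerivAt`. [folklore] -/
theorem boostedZone_fderiv_cruxTerm_self (M : ℝ) (Λ : lorentzGroup) (c x : E4)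
    (hx : 0 < Kerr.radius 0 (poincareInv Λ c x)) (μ ν : Fin 4) :
    fderiv ℝ (fun y ↦ Real.smoothTransition (2 - Kerr.radius 0 (poincareInv Λ c y) / (8 * M)) *
        (2 * Kerr.scalarH M 0 (poincareInv Λ c y)) *
        ((Λ : E4 ≃L[ℝ] E4) (Kerr.nullVector 0 (poincareInv Λ c y))) μ *
        ((Λ : E4 ≃L[ℝ] E4) (Kerr.nullVector 0 (poincareInv Λ c y))) ν) x (x - c) =
      (Kerr.radius 0 (poincareInv Λ c x) *
            deriv (fun s ↦ Real.smoothTransition (2 - s / (8 * M)))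
              (Kerr.radius 0 (poincareInv Λ c x)) -
          Real.smoothTransition (2 - Kerr.radius 0 (poincareInv Λ c x) / (8 * M))) *
        (2 * Kerr.scalarH M 0 (poincareInv Λ c x)) *
        ((Λ : E4 ≃L[ℝ] E4) (Kerr.nullVector 0 (poincareInv Λ c x))) μ *
        ((Λ : E4 ≃L[ℝ] E4) (Kerr.nullVector 0 (poincareInv Λ c x))) ν := by
  have key := boostedZone_fderiv_apply_sub_eq_of_hasDerivAt (c := c)
    (boostedZone_differentiableAt_cruxTerm M 0 Λ c hx μ ν)
    (zonePumping_hasDerivAt_profile (zonePumping_differentiable_cutoff M)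
      (Kerr.radius 0 (poincareInv Λ c x))
      (2 * Kerr.scalarH M 0 (poincareInv Λ c x) *
        ((Λ : E4 ≃L[ℝ] E4) (Kerr.nullVector 0 (poincareInv Λ c x))) μ *
        ((Λ : E4 ≃L[ℝ] E4) (Kerr.nullVector 0 (poincareInv Λ c x))) ν))
    (fun t ht ↦ by
      simp only [boostedZone_poincareInv_center_add_smul]
      exact boostedZone_cruxTerm_smul M (Λ : E4 ≃L[ℝ] E4) (poincareInv Λ c x) μ ν ht)
  rw [key]
  ring

/-- **Euler / null-dust pumping identity for the BOOSTED zone term of the crux field** (`a = 0`):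
for the hole passing through the event `c = (0, p)` with 4-velocity `Λ ∂_{t*}`, the zone term
`T(y)^{μν} = χ(r) · 2H · (Λℓ♯)^μ (Λℓ♯)^ν` (all evaluated at `q y = Λ⁻¹(y − c)`, `r = Kerr.radius 0`,
`H = M/r`, `χ(r) = Real.smoothTransition (2 − r/(8M))`) satisfies
`dT(x)[x − c] = (r χ'(r) − χ(r)) · 2H · (Λℓ♯)^μ (Λℓ♯)^ν` wherever `r(q x) > 0`
(`boostedZone_fderiv_cruxTerm_self`; Kerr–Schild 1965, §2; Euler's identity). [folklore] -/
theorem fderiv_cruxTerm_self_schwarzschild : ∀ (M : ℝ) (Λ : lorentzGroup) (p : E3) (x : E4) (hx : 0 < Kerr.radius 0 (poincareInv Λ (E4.ofTimeSpace 0 p) x)) (μ ν : Fin 4), fderiv ℝ (fun y ↦ Real.smoothTransition (2 - Kerr.radius 0 (poincareInv Λ (E4.ofTimeSpace 0 p) y) / (8 * M)) * (2 * Kerr.scalarH M 0 (poincareInv Λ (E4.ofTimeSpace 0 p) y)) * ((Λ : E4 ≃L[ℝ] E4) (Kerr.nullVector 0 (poincareInv Λ (E4.ofTimeSpace 0 p)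 y))) μ * ((Λ : E4 ≃L[ℝ] E4) (Kerr.nullVector 0 (poincareInv Λ (E4.ofTimeSpace 0 p) y))) ν) x (x - E4.ofTimeSpace 0 p) = (Kerr.radius 0 (poincareInv Λ (E4.ofTimeSpace 0 p) x) * deriv (fun s ↦ Real.smoothTransition (2 - s / (8 * M))) (Kerr.radius 0 (poincareInv Λ (E4.ofTimeSpace 0 p) x)) - Real.smoothTransition (2 - Kerr.radius 0 (poincareInv Λ (E4.ofTimeSpace 0 p) x) / (8 * M))) * (2 * Kerr.scalarH M 0 (poincareInv Λ (E4.ofTimeSpace 0 p) x)) * ((Λ : E4 ≃L[ℝ] E4) (Kerr.nullVector 0 (poincareInv Λ (E4.ofTimeSpace 0 p) x))) μ * ((Λ : E4 ≃L[ℝ] E4) (Kerr.nullVector 0 (poincareInv Λ (E4.ofTimeSpace 0 p) x))) ν := by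
  intro M Λ p x hx μ ν
  exact boostedZone_fderiv_cruxTerm_self M Λ (E4.ofTimeSpace 0 p) x hx μ ν

/-! ### Stationarity along the boost direction -/

/-- **The boosted zone term is invariant along the boost direction** `u = Λ ∂_{t*}` (all `M, a`,
any centre `c`): `q(x + s u) = q x + s ∂_{t*}` (`boostedZone_poincareInv_add_smul_map`) and `r`,
`H`, `ℓ♯` are invariant under `t*`-translations (`Kerr.radius_add_time_smul_basisVector`,
`Kerr.scalarH_add_smul_basisVector_zero`, `Kerr.nullVector_add_smul_basisVector_zero`).
[folklore] -/
theorem boostedZone_cruxTerm_add_smul_boost (M a : ℝ) (Λ : lorentzGroup) (c x : E4)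
    (μ ν : Fin 4) (s : ℝ) :
    Real.smoothTransition (2 - Kerr.radius a (poincareInv Λ c
          (x + s • (Λ : E4 ≃L[ℝ] E4) (E4.basisVector 0))) / (8 * M)) *
        (2 * Kerr.scalarH M a
          (poincareInv Λ c (x + s • (Λ : E4 ≃L[ℝ] E4) (E4.basisVector 0)))) *
        ((Λ : E4 ≃L[ℝ] E4) (Kerr.nullVector a
          (poincareInv Λ c (x + s • (Λ : E4 ≃L[ℝ] E4) (E4.basisVector 0))))) μ *
        ((Λ : E4 ≃L[ℝ] E4) (Kerr.nullVector a
          (poincareInv Λ c (x + s • (Λ : E4 ≃L[ℝ] E4) (E4.basisVector 0))))) ν =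
      Real.smoothTransition (2 - Kerr.radius a (poincareInv Λ c x) / (8 * M)) *
        (2 * Kerr.scalarH M a (poincareInv Λ c x)) *
        ((Λ : E4 ≃L[ℝ] E4) (Kerr.nullVector a (poincareInv Λ c x))) μ *
        ((Λ : E4 ≃L[ℝ] E4) (Kerr.nullVector a (poincareInv Λ c x))) ν := by
  rw [boostedZone_poincareInv_add_smul_map, Kerr.radius_add_time_smul_basisVector,
    Kerr.scalarH_add_smul_basisVector_zero, Kerr.nullVector_add_smul_basisVector_zero]

/-- **Boost-stationarity of the BOOSTED zone term of the crux field** (all `M, a`): for the hole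
passing through the event `c = (0, p)` with 4-velocity `u = Λ ∂_{t*}`, the zone term
`T(y)^{μν} = χ(r) · 2H · (Λℓ♯)^μ (Λℓ♯)^ν` (evaluated at `q y = Λ⁻¹(y − c)`) is constant along the
lab lines `s ↦ x + s u` (`boostedZone_cruxTerm_add_smul_boost`), so `dT(x)[Λ ∂_{t*}] = 0` at every
point (`zoneDiv_fderiv_apply_eq_zero_of_forall_add_smul`; where `T` is not differentiable the
derivative is `0` by convention). Kerr–Schild 1965, §2 (stationarity of Kerr). [folklore] -/
theorem fderiv_cruxTerm_boostDirection_zero : ∀ (M a : ℝ) (Λ : lorentzGroup) (p : E3) (x : E4) (μ ν : Fin 4), fderiv ℝ (fun y ↦ Real.smoothTransition (2 - Kerr.radius a (poincareInv Λ (E4.ofTimeSpace 0 p) y) / (8 * M)) * (2 * Kerr.scalarH M a (poincareInv Λ (E4.ofTimeSpace 0 p) y)) * ((Λ : E4 ≃L[ℝ] E4) (Kerr.nullVector a (poincareInv Λ (E4.ofTimeSpace 0 p) y))) μ * ((Λ : E4 ≃L[ℝ] E4) (Kerr.nullVector a (poincareInv Λ (E4.ofTimeSpace 0 p) y))) ν)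 x ((Λ : E4 ≃L[ℝ] E4) (E4.basisVector 0)) = 0 := by
  intro M a Λ p x μ ν
  exact zoneDiv_fderiv_apply_eq_zero_of_forall_add_smul fun s ↦
    boostedZone_cruxTerm_add_smul_boost M a Λ (E4.ofTimeSpace 0 p) x μ ν s

end Summit.FinalStateConjecture.FinalStateConjecture.Theorems
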